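import Summits.CriticalPhenomena.CardyFormulaZ2.Theorems.CardyBoundaryCoulombGasBoundaryDefectGaussianRStubGreenKernelAsymptoticsPart5
import Summits.CriticalPhenomena.CardyFormulaZ2.Theorems.CardyBoundaryCoulombGasBoundaryDefectGaussianRStubReferenceLimitPart6
import Literature.Probability.LatticeModels.FlatBoundaryPoissonKernelLimitProofs
import Literature.Probability.LatticeModels.BoundaryNormalisedPoissonKernelLimitProofs
import HarnessLib

/-!
# Hardness certificate of crux `BoundaryDefectGaussianR` (stmt-CriticalPhenomena-14132), line
# `rainbow-monomials-in-excursion-kernels` — stub H6 `h19_boxGreen`: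
# the Dirichlet Green function of the lattice squares between the two bottom-row marks

Along the lattice squares `V_n = {v : δ_n v ∈ [-1, 1]²} = [-12(n+1), 12(n+1)]²` (mesh
`δ_n = 1/(12(n+1))`), the Dirichlet Green function between the bottom-row points
`p_n 0 = (-4(n+1), -12(n+1))` and `p_n 1 = (4(n+1), -12(n+1))` satisfies
`G_{V_n}(p_n 0, p_n 1)/δ_n² → K` for some `K > 0`, given a conformal map `w` of the square `(-1,1)²`
onto `ℍ`, holomorphic on a neighbourhood of the square and of its open bottom side, with `Re w`
strictly increasing along the bottom side. This is the landed Green asymptotics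
`greenKernelAsymptotics_of_facts` (both of its named facts, `Kenyon2000_flatEdgePoissonKernelLimit`
and `ChelkakSmirnov2011_boundaryNormalisedPoissonKernelLimit`, are proved in `Literature`) for the
square `rectDomain 1 1` at the two boundary points `x = -1/3 - i`, `y = 1/3 - i` (the rescaled
lattice points are constant in `n`), with `K = c · |w′(x)| |w′(y)| / |w(x) - w(y)|² > 0`:
`w(x) ≠ w(y)` by strict monotonicity and `w′ ≠ 0` at `x`, `y` by `transfer_deriv_ne_zero` (the open
half-disc above a point of the open bottom side lies in the square, `Im w > 0` inside, `Im w = 0` on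
the boundary by `transfer_im_eq_zero_of_frontier`).
-/

noncomputable section

namespace Summit.CriticalPhenomena.CardyFormulaZ2.Cruxes.BoundaryDefectGaussianR.RainbowMonomialsInExcursionKernels

open Filter Topology Set
open Literature.Probability.RandomPlanarGeometry Literature.Probability.LatticeModels
  Literature.Probability.LatticeModels.CollarLegModel

/-! ### Points of the open bottom side of the square -/

/-- A point `x - i` of the open bottom side (`-1 < x < 1`) lies on the frontier of the square.
[folklore] -/
theorem bgreen_mark_mem_frontier {x : ℝ} (h1 : -1 < x) (h2 : x < 1) :
    (⟨x, -1⟩ : ℂ) ∈ frontier (symRect 1 1) := by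
  rw [mem_frontier_symRect one_pos one_pos]
  exact Or.inl ⟨⟨h1.le, h2.le⟩, Or.inl rfl⟩

/-- The frontier of the square is horizontal near a point of the open bottom side. [folklore] -/
theorem bgreen_mark_flat {x : ℝ} (h1 : -1 < x) (h2 : x < 1) :
    ∃ r : ℝ, 0 < r ∧ ((∀ z ∈ frontier (symRect 1 1), dist z (⟨x, -1⟩ : ℂ) < r → z.im = (⟨x, -1⟩ : ℂ).im) ∨
      (∀ z ∈ frontier (symRect 1 1), dist z (⟨x, -1⟩ : ℂ) < r → z.re = (⟨x, -1⟩ : ℂ).re)) :=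
  ⟨min (1 - x) (1 + x), lt_min (by linarith) (by linarith),
    Or.inl fun _ hz hd ↦ frontier_square_flat_bottom hz hd⟩

/-- The open half-disc of radius `min (1 - x) (1 + x)` above a point `x - i` of the open bottom side
(the side of the inward normal `ν = i`) lies in the square. [folklore] -/
theorem bgreen_halfDisc_subset {x : ℝ} (z : ℂ) (hd : dist z (⟨x, -1⟩ : ℂ) < min (1 - x) (1 + x))
    (him : 0 < ((z - ⟨x, -1⟩) / Complex.I).re) : z ∈ symRect 1 1 := by
  have hre : |z.re - x| ≤ dist z ⟨x, -1⟩ := by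
    rw [Complex.dist_eq]; simpa using Complex.abs_re_le_norm (z - ⟨x, -1⟩)
  have him' : |z.im + 1| ≤ dist z ⟨x, -1⟩ := by
    rw [Complex.dist_eq]; simpa using Complex.abs_im_le_norm (z - ⟨x, -1⟩)
  have h0 : ((z - ⟨x, -1⟩) / Complex.I).re = z.im + 1 := by
    simp [Complex.div_I]
  rw [h0] at him
  have hd1 : dist z ⟨x, -1⟩ < 1 - x := lt_of_lt_of_le hd (min_le_left _ _)
  have hd2 : dist z ⟨x, -1⟩ < 1 + x := lt_of_lt_of_le hd (min_le_right _ _)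
  rw [abs_le] at hre him'
  rw [mem_symRect]
  exact ⟨⟨by linarith [hre.1], by linarith [hre.2]⟩, by linarith, by linarith [him'.2]⟩

/-- **Non-vanishing derivative at a point of the open bottom side.** For `w` holomorphic on an open
`U ⊇ (-1,1)²` containing the point `x - i` (`-1 < x < 1`) and mapping the square bijectively onto `ℍ`,
`w′(x - i) ≠ 0` (`transfer_deriv_ne_zero` at the flat boundary point, inward normal `i`). [folklore] -/
theorem bgreen_deriv_ne_zero {w : ℂ → ℂ} {U : Set ℂ} (hU : IsOpen U) (hSU : symRect 1 1 ⊆ U)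
    (hw : DifferentiableOn ℂ w U) (hbij : Set.BijOn w (symRect 1 1) {z : ℂ | 0 < z.im})
    {x : ℝ} (h1 : -1 < x) (h2 : x < 1) (hxU : (⟨x, -1⟩ : ℂ) ∈ U) : deriv w ⟨x, -1⟩ ≠ 0 :=
  transfer_deriv_ne_zero (Ω := symRect 1 1) (ν := Complex.I) (by simp) (lt_min (by linarith) (by linarith))
    (fun z hd him ↦ bgreen_halfDisc_subset z hd him) (fun _ hz ↦ hbij.mapsTo hz)
    (transfer_im_eq_zero_of_frontier (isOpen_symRect 1 1) hU hSU hw hbij (bgreen_mark_mem_frontier h1 h2) hxU)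
    (hw.analyticAt (hU.mem_nhds hxU)) hbij.injOn

/-! ### The lattice squares and the two bottom-row points -/

/-- At mesh `δ_n = 1/(12(n+1))` the lattice points of the closed square form the box
`[-12(n+1), -12(n+1) + 24(n+1)]²` (`square_latticeBox`). [folklore] -/
theorem bgreen_box {δ : ℝ} {n : ℕ} (hδ : δ = 1 / (12 * ((n : ℝ) + 1))) {V : Finset (ℤ × ℤ)}
    (hV : ∀ v : ℤ × ℤ, v ∈ V ↔
      ((v.1 : ℂ) * ((δ : ℝ) : ℂ) + (v.2 : ℂ) * ((δ : ℝ) : ℂ) * Complex.I) ∈ closure (symRect 1 1)) :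
    ∀ v : ℤ × ℤ, v ∈ V ↔
      (-(12 * ((n : ℤ) + 1)) ≤ v.1 ∧ v.1 ≤ -(12 * ((n : ℤ) + 1)) + ((24 * (n + 1) : ℕ) : ℤ)) ∧
      (-(12 * ((n : ℤ) + 1)) ≤ v.2 ∧ v.2 ≤ -(12 * ((n : ℤ) + 1)) + ((24 * (n + 1) : ℕ) : ℤ)) := by
  have hδpos : 0 < δ := by rw [hδ]; positivity
  have hA : ⌊1 / δ⌋₊ = 12 * (n + 1) := by
    rw [hδ, one_div_one_div]
    have e : (12 * ((n : ℝ) + 1)) = ((12 * (n + 1) : ℕ) : ℝ) := by push_cast; ring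
    rw [e, Nat.floor_natCast]
  intro v
  rw [square_latticeBox hδpos hV v, hA]
  push_cast
  omega

/-- The rescaled lattice point `(a, b)` at mesh `δ` is the complex number `aδ + bδ i`. [folklore] -/
theorem bgreen_meshPoint_eq (a b : ℤ) (δ : ℝ) :
    ((a : ℂ) * ((δ : ℝ) : ℂ) + (b : ℂ) * ((δ : ℝ) : ℂ) * Complex.I) = ⟨a * δ, b * δ⟩ := by
  apply Complex.ext <;> simp

/-- The rescaled bottom-row points `(4m(n+1), -12(n+1)) δ_n` are the constant points `m/3 - i`.
[folklore] -/
theorem bgreen_rescale (m : ℤ) (n : ℕ) {δ : ℝ} (hδ : δ = 1 / (12 * ((n : ℝ) + 1))) :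
    ((((4 * m * ((n : ℤ) + 1) : ℤ) : ℂ) * ((δ : ℝ) : ℂ) +
      ((-(12 * ((n : ℤ) + 1)) : ℤ) : ℂ) * ((δ : ℝ) : ℂ) * Complex.I)) = ⟨(m : ℝ) / 3, -1⟩ := by
  rw [bgreen_meshPoint_eq, hδ]
  have hn : (n : ℝ) + 1 ≠ 0 := by positivity
  apply Complex.ext
  · push_cast; field_simp; ring
  · push_cast; field_simp

/-! ### The stub -/

/-- **Stub H6.** Along the lattice squares, `G_{V_n}(p_n 0, p_n 1) / δ_n² → K > 0` (the landed Green
asymptotics GREEN `greenKernelAsymptotics_of_facts` with both named facts proved, fed with a conformal map of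
the square as in Stub H1; `K = c · |w′(x)||w′(y)|/|w(x) - w(y)|² > 0` by strict monotonicity of `Re w` on
the bottom side and `transfer_deriv_ne_zero`). [folklore] -/
theorem h19_boxGreen :
    (∃ (w : ℂ → ℂ) (U : Set ℂ), IsOpen U ∧ Literature.Probability.RandomPlanarGeometry.symRect 1 1 ⊆ U ∧
      (∀ x : ℝ, -1 < x → x < 1 → (⟨x, -1⟩ : ℂ) ∈ U) ∧ DifferentiableOn ℂ w U ∧
      Set.BijOn w (Literature.Probability.RandomPlanarGeometry.symRect 1 1) {z : ℂ | 0 < z.im} ∧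
      StrictMonoOn (fun x : ℝ ↦ (w ⟨x, -1⟩).re) (Set.Ioo (-1) 1)) →
    ∀ (δ : ℕ → ℝ) (V : ℕ → Finset (ℤ × ℤ)) (p : ℕ → Fin 2 → ℤ × ℤ),
    (∀ n, δ n = 1 / (12 * ((n : ℝ) + 1))) →
    (∀ n, ∀ v : ℤ × ℤ, v ∈ V n ↔ ((v.1 : ℂ) * ((δ n : ℝ) : ℂ) + (v.2 : ℂ) * ((δ n : ℝ) : ℂ) * Complex.I) ∈
      closure (Literature.Probability.RandomPlanarGeometry.symRect 1 1)) →
    (∀ n, p n 0 = (-(4 * ((n : ℤ) + 1)), -(12 * ((n : ℤ) + 1)))) →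
    (∀ n, p n 1 = (4 * ((n : ℤ) + 1), -(12 * ((n : ℤ) + 1)))) →
    ∃ K : ℝ, 0 < K ∧ Filter.Tendsto (fun n ↦
      Literature.Probability.LatticeModels.dirichletGreen ((V n).image (fun v : ℤ × ℤ ↦ (![v.1, v.2] : Fin 2 → ℤ)))
        (![(p n 0).1, (p n 0).2] : Fin 2 → ℤ) (![(p n 1).1, (p n 1).2] : Fin 2 → ℤ) / (δ n) ^ 2)
      Filter.atTop (nhds K) := by
  rintro ⟨w, U, hU, hSU, hbot, hw, hbij, hmono⟩ δ V p hδ hV hp0 hp1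
  obtain ⟨c, hc, hmain⟩ := greenKernelAsymptotics_of_facts Kenyon2000_flatEdgePoissonKernelLimit_holds
    ChelkakSmirnov2011_boundaryNormalisedPoissonKernelLimit_holds
  -- the two marks `∓1/3 - i`
  have hx1 : (-1 : ℝ) < -1 / 3 := by norm_num
  have hx2 : (-1 / 3 : ℝ) < 1 := by norm_num
  have hy1 : (-1 : ℝ) < 1 / 3 := by norm_num
  have hy2 : (1 / 3 : ℝ) < 1 := by norm_num
  have hlt : (w ⟨(-1 / 3 : ℝ), -1⟩).re < (w ⟨(1 / 3 : ℝ), -1⟩).re :=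
    hmono ⟨hx1, hx2⟩ ⟨hy1, hy2⟩ (by norm_num)
  have hxy : (⟨(-1 / 3 : ℝ), -1⟩ : ℂ) ≠ ⟨(1 / 3 : ℝ), -1⟩ := fun h ↦ by
    rw [h] at hlt
    exact lt_irrefl _ hlt
  have hwxy : w ⟨(-1 / 3 : ℝ), -1⟩ - w ⟨(1 / 3 : ℝ), -1⟩ ≠ 0 := fun h ↦ by
    rw [sub_eq_zero] at h
    rw [h] at hlt
    exact lt_irrefl _ hlt
  have hdx := bgreen_deriv_ne_zero hU hSU hw hbij hx1 hx2 (hbot _ hx1 hx2)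
  have hdy := bgreen_deriv_ne_zero hU hSU hw hbij hy1 hy2 (hbot _ hy1 hy2)
  -- the meshes
  have hδpos : ∀ n, 0 < δ n := fun n ↦ by rw [hδ n]; positivity
  have hδ0 : Tendsto δ atTop (𝓝 0) := by
    have h := (tendsto_one_div_add_atTop_nhds_zero_nat (𝕜 := ℝ)).const_mul (1 / 12 : ℝ)
    rw [mul_zero] at h
    exact h.congr fun n ↦ by rw [hδ n, one_div_mul_one_div]
  -- the two bottom-row lattice points
  have hbox := fun n ↦ bgreen_box (hδ n) (hV n)
  have ha : ∀ n, p n 0 ∈ V n ∧ ((neighbours (p n 0)).filter (fun u ↦ u ∉ V n)).card = 1 := by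
    intro n
    rw [hp0 n]
    exact ⟨by rw [hbox n]; push_cast; omega,
      card_neighbours_filter_bottom (hbox n) (by positivity) (by omega) (by push_cast; omega)⟩
  have hb : ∀ n, p n 1 ∈ V n ∧ ((neighbours (p n 1)).filter (fun u ↦ u ∉ V n)).card = 1 := by
    intro n
    rw [hp1 n]
    exact ⟨by rw [hbox n]; push_cast; omega,
      card_neighbours_filter_bottom (hbox n) (by positivity) (by omega) (by push_cast; omega)⟩
  have hax : Tendsto (fun n ↦ (((p n 0).1 : ℂ) * ((δ n : ℝ) : ℂ) + ((p n 0).2 : ℂ) * ((δ n : ℝ) : ℂ) *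
      Complex.I)) atTop (𝓝 ⟨(-1 / 3 : ℝ), -1⟩) := by
    refine tendsto_const_nhds.congr fun n ↦ ?_
    have e : p n 0 = (4 * (-1) * ((n : ℤ) + 1), -(12 * ((n : ℤ) + 1))) := by rw [hp0 n]; ring_nf
    rw [e, bgreen_rescale (-1) n (hδ n)]
    push_cast
    ring_nf
  have hby : Tendsto (fun n ↦ (((p n 1).1 : ℂ) * ((δ n : ℝ) : ℂ) + ((p n 1).2 : ℂ) * ((δ n : ℝ) : ℂ) *
      Complex.I)) atTop (𝓝 ⟨(1 / 3 : ℝ), -1⟩) := by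
    refine tendsto_const_nhds.congr fun n ↦ ?_
    have e : p n 1 = (4 * 1 * ((n : ℤ) + 1), -(12 * ((n : ℤ) + 1))) := by rw [hp1 n]; ring_nf
    rw [e, bgreen_rescale 1 n (hδ n)]
    push_cast
    ring_nf
  -- GREEN on the square
  have hT := hmain (rectDomain 1 1 one_pos one_pos) ⟨_, square_sides_axisParallel, frontier_square_subset⟩
    ⟨(-1 / 3 : ℝ), -1⟩ ⟨(1 / 3 : ℝ), -1⟩ (bgreen_mark_mem_frontier hx1 hx2) (bgreen_mark_mem_frontier hy1 hy2)
    hxy (bgreen_mark_flat hx1 hx2) (bgreen_mark_flat hy1 hy2) w U hU hSU (hbot _ hx1 hx2) (hbot _ hy1 hy2)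
    hw hbij δ hδpos hδ0 V hV (fun n ↦ p n 0) (fun n ↦ p n 1) ha hb hax hby
  refine ⟨c * (‖deriv w ⟨(-1 / 3 : ℝ), -1⟩‖ * ‖deriv w ⟨(1 / 3 : ℝ), -1⟩‖ /
    ‖w ⟨(-1 / 3 : ℝ), -1⟩ - w ⟨(1 / 3 : ℝ), -1⟩‖ ^ 2), ?_, hT⟩
  have h1 := norm_pos_iff.mpr hdx
  have h2 := norm_pos_iff.mpr hdy
  have h3 := norm_pos_iff.mpr hwxy
  positivity

end Summit.CriticalPhenomena.CardyFormulaZ2.Cruxes.BoundaryDefectGaussianR.RainbowMonomialsInExcursionKernels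

end
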